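import Literature.MathematicalPhysics.QuantumFieldTheory.TorusLoopLinkRP
import HarnessLib

/-!
# Reflection positivity in lattice hyperplanes for the even torus and log-convexity of
even-height Wilson loops

For the torus Wilson state on the even torus `(ℤ/Lℤ)^d` (`β` real, continuous matrix
representation `ρ` of the compact gauge group `G`), this file proves the reflection-positivity
inequalities for rectangular Wilson loops `W(n, m) = ⟨W_{n×m}⟩_{Λ,β}` in the `(0, j)` plane that
come from the reflection `θ₀ t = -t` in the **lattice** hyperplanes `t = 0` and `t = L/2`
(Osterwalder–Seiler 1978 §2, "reflections in lattice planes"; Fröhlich–Israel–Lieb–Simon 1978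
Thm. 2.1):

* `wilsonExpectation_wilsonLoop_nonneg_of_even` — `0 ≤ W(2b, m)`;
* `wilsonExpectation_wilsonLoop_sq_le_of_site` — `W(b + a, m)² ≤ W(2b, m) · W(2a, m)`
  (`1 ≤ a, b`, `a + 1, b + 1 ≤ L/2`).

Together with the odd-height inequalities of `TorusLoopLinkRP` (reflection between lattice
planes) these give the log-convexity `W(n)² ≤ W(n-1) W(n+1)` for all `n ≥ 2` on even tori,
the input of `StringTension.hasStringTension_of_eventually` (named fact
`exists_hasStringTension`).

## The argument

The reflection on configurations is `Θ₀ U = Θ (τ U)` — Wave 0's link-plane reflection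
`GaugeConfig.timeReflect` after the unit time translation `torusConfigShift e₀` — so that its
measure preservation and its action on plaquettes come from the tree
(`WilsonRP.measurePreserving_timeReflect`, `WilsonRP.plaqRe_timeReflect`,
`plaquetteHolonomy_torusConfigShift`). Relative to `Θ₀` the links split into the block `P₀`
(both endpoints in `{0, …, L/2}`, not inside a reflection plane), the shared block `M₀` (spatial
links inside the planes `t = 0`, `t = L/2`, fixed by `Θ₀`) and the reflected block; there are no
crossing links. The plaquettes split accordingly, `∑ₚ Re tr ρ(U_p) = A₀(U) + A₀(Θ₀U) + A_M(U)`
(`sum_plaqRe_eq_site`), and the abstract mechanism with a shared block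
(`LatticeRP.integral_mul_conj_mul_exp_nonneg_of_shared` with `C = ∅` and no Gram factor,
through `LatticeRP.re_sum_pair_sq_le`) applies to `g = F · e^{β(A₀ + A_M/2)}`. A rectangular
loop of height `b + a` placed with `b` links below and `a` links above the plane `t = L/2` is
conjugate to `S_a(Θ₀U)⁻¹… ` — precisely `Re tr ρ(hol) = ∑_{kl} Re (σ(S_b(U))_{kl} conj σ(S_a(Θ₀U))_{kl})`
for the **downward staples** `S_h` hanging from the plane (`re_trace_rectangleHolonomy_eq_sum_down`,
written for an abstract reflection so that the odd torus can reuse it), whence the Schwarz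
inequality and translation invariance give the claims. Everything here is proved; no
definitions (the blocks are written as explicit `Finset.filter`s).

## References

* K. Osterwalder, E. Seiler, Ann. Phys. 110 (1978) 440, §2; E. Seiler, LNP 159 (1982), §2.
* J. Fröhlich, R. Israel, E. H. Lieb, B. Simon, Commun. Math. Phys. 62 (1978) 1, Thm. 2.1.
-/

noncomputable section

open MeasureTheory Finset Complex
open scoped ComplexOrder ComplexConjugate

namespace Literature.MathematicalPhysics.QuantumFieldTheory

namespace StringTension

open WilsonRP LatticeRP Literature.RepresentationTheory.CompactGroups

variable {d L N : ℕ} [NeZero d] [NeZero L] [Fact (1 < L)]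
variable {G : Type*} [Group G] [TopologicalSpace G] [IsTopologicalGroup G] [CompactSpace G]
  [MeasurableSpace G] [BorelSpace G]
variable (ρ : G →* Matrix (Fin N) (Fin N) ℂ)

/-! ### Lines determined by their links -/

section Lines

omit [NeZero d] [NeZero L] [Fact (1 < L)] [TopologicalSpace G] [IsTopologicalGroup G] [CompactSpace G]
  [MeasurableSpace G] [BorelSpace G] in
/-- Two lines with pairwise equal links have equal holonomies. [folklore] -/
theorem lineHolonomy_eq_of_links (V U : GaugeConfig d L G) (k : Fin d) :
    ∀ (n : ℕ) (y y' : Site d L),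
      (∀ s : ℕ, s < n → V (y + Pi.single k ((s : ℕ) : ZMod L), k) =
        U (y' + Pi.single k ((s : ℕ) : ZMod L), k)) →
      lineHolonomy V k n y = lineHolonomy U k n y'
  | 0, _, _, _ => rfl
  | n + 1, y, y', h => by
      rw [lineHolonomy_succ, lineHolonomy_succ]
      have h0 := h 0 (Nat.succ_pos n)
      simp only [Nat.cast_zero, Pi.single_zero, add_zero] at h0
      rw [h0, lineHolonomy_eq_of_links V U k n (y.shift k) (y'.shift k) fun s hs => ?_]
      have := h (s + 1) (by omega)
      rwa [← shift_add_single, ← shift_add_single] at this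

omit [NeZero d] [NeZero L] [Fact (1 < L)] [TopologicalSpace G] [IsTopologicalGroup G] [CompactSpace G]
  [MeasurableSpace G] [BorelSpace G] in
/-- **A line whose links are the inverses of the links of another line, in reverse order, has
the inverse holonomy** (the mechanism behind the reflection of time-like lines). [folklore] -/
theorem lineHolonomy_eq_inv_of_links (V U : GaugeConfig d L G) (k : Fin d) :
    ∀ (n : ℕ) (y y' : Site d L),
      (∀ s : ℕ, s < n → V (y + Pi.single k ((s : ℕ) : ZMod L), k) =
        (U (y' + Pi.single k (((n - 1 - s : ℕ)) : ZMod L), k))⁻¹) →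
      lineHolonomy V k n y = (lineHolonomy U k n y')⁻¹
  | 0, _, _, _ => by simp
  | n + 1, y, y', h => by
      rw [lineHolonomy_succ, lineHolonomy_succ_right, mul_inv_rev]
      have h0 := h 0 (Nat.succ_pos n)
      simp only [Nat.cast_zero, Pi.single_zero, add_zero, Nat.sub_zero, Nat.add_sub_cancel] at h0
      rw [h0, lineHolonomy_eq_inv_of_links V U k n (y.shift k) y' fun s hs => ?_]
      have := h (s + 1) (by omega)
      rw [← shift_add_single, show n + 1 - 1 - (s + 1) = n - 1 - s by omega] at this
      exact this

end Lines

/-! ### Downward staples and the rectangle cut by a lattice plane -/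

section DownStaples

variable {c : Site d L} {j : Fin d}

omit [NeZero L] [Fact (1 < L)] [TopologicalSpace G] [IsTopologicalGroup G] [CompactSpace G]
  [MeasurableSpace G] [BorelSpace G] in
/-- **The rectangle cut by a lattice plane, as a conjugate.** For a loop based at `x = c - b e₀`
with `b + (a + 1)` time-like and `m` spatial steps (the plane being that of `c`):
`hol = k · (Up_{a+1}(U) · S_b(U)⁻¹) · k⁻¹`, where `Up_h` is the upward staple from the plane,
`S_b(U) = P(x → c)⁻¹ P(x → x + m eⱼ) P(x + m eⱼ → c + m eⱼ)` the downward staple and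
`k = P(x → c)`. [folklore] -/
theorem rectangleHolonomy_eq_conj_downStaples (U : GaugeConfig d L G) (c : Site d L) (j : Fin d)
    (b a m : ℕ) :
    rectangleHolonomy U (c + Pi.single 0 (-((b : ℕ) : ZMod L))) 0 j (b + (a + 1)) m =
      lineHolonomy U 0 b (c + Pi.single 0 (-((b : ℕ) : ZMod L))) *
        ((lineHolonomy U 0 (a + 1) c * lineHolonomy U j m (c + Pi.single 0 (((a + 1 : ℕ)) : ZMod L)) *
            (lineHolonomy U 0 (a + 1) (c + Pi.single j ((m : ℕ) : ZMod L)))⁻¹) *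
          ((lineHolonomy U 0 b (c + Pi.single 0 (-((b : ℕ) : ZMod L))))⁻¹ *
            lineHolonomy U j m (c + Pi.single 0 (-((b : ℕ) : ZMod L))) *
            lineHolonomy U 0 b (c + Pi.single 0 (-((b : ℕ) : ZMod L)) + Pi.single j ((m : ℕ) : ZMod L)))⁻¹) *
        (lineHolonomy U 0 b (c + Pi.single 0 (-((b : ℕ) : ZMod L))))⁻¹ := by
  rw [rectangleHolonomy_eq_split]
  group

omit [NeZero L] [Fact (1 < L)] [MeasurableSpace G] [BorelSpace G] in
/-- **The loop cut by a lattice plane as a scalar product of downward staples.** If the upward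
staple of height `a + 1` from the plane of `c` equals the downward staple of the reflected
configuration `V = RU` (hypothesis `hUp`, the action of the lattice-plane reflection `R` on the
staple), then `Re tr ρ(hol) = ∑_{kl} Re (σ(S_b(U))_{kl} conj σ(S_{a+1}(V))_{kl})` for the
unitarised representation `σ`. [folklore] -/
theorem re_trace_rectangleHolonomy_eq_sum_down (hρ : Continuous ρ) (U V : GaugeConfig d L G)
    (c : Site d L) (j : Fin d) (b a m : ℕ)
    (hUp : lineHolonomy U 0 (a + 1) c * lineHolonomy U j m (c + Pi.single 0 (((a + 1 : ℕ)) : ZMod L)) *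
        (lineHolonomy U 0 (a + 1) (c + Pi.single j ((m : ℕ) : ZMod L)))⁻¹ =
      (lineHolonomy V 0 (a + 1) (c + Pi.single 0 (-(((a + 1 : ℕ)) : ZMod L))))⁻¹ *
        lineHolonomy V j m (c + Pi.single 0 (-(((a + 1 : ℕ)) : ZMod L))) *
        lineHolonomy V 0 (a + 1) (c + Pi.single 0 (-(((a + 1 : ℕ)) : ZMod L)) + Pi.single j ((m : ℕ) : ZMod L))) :
    ((ρ (rectangleHolonomy U (c + Pi.single 0 (-((b : ℕ) : ZMod L))) 0 j (b + (a + 1)) m)).trace).re =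
      ∑ k, ∑ l,
        (CompactGroup.unitarize ρ hρ
            ((lineHolonomy U 0 b (c + Pi.single 0 (-((b : ℕ) : ZMod L))))⁻¹ *
              lineHolonomy U j m (c + Pi.single 0 (-((b : ℕ) : ZMod L))) *
              lineHolonomy U 0 b (c + Pi.single 0 (-((b : ℕ) : ZMod L)) + Pi.single j ((m : ℕ) : ZMod L))) k l *
          conj (CompactGroup.unitarize ρ hρ
            ((lineHolonomy V 0 (a + 1) (c + Pi.single 0 (-(((a + 1 : ℕ)) : ZMod L))))⁻¹ *
              lineHolonomy V j m (c + Pi.single 0 (-(((a + 1 : ℕ)) : ZMod L))) *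
              lineHolonomy V 0 (a + 1) (c + Pi.single 0 (-(((a + 1 : ℕ)) : ZMod L)) +
                Pi.single j ((m : ℕ) : ZMod L))) k l)).re := by
  rw [rectangleHolonomy_eq_conj_downStaples, CompactGroup.trace_conj_eq, hUp,
    ← CompactGroup.re_trace_map_inv ρ hρ, mul_inv_rev, inv_inv,
    CompactGroup.re_trace_mul_inv_eq_sum ρ hρ]

end DownStaples

/-! ### The lattice-plane reflection `Θ₀ = Θ ∘ τ` -/

section SiteReflection

omit [NeZero L] [Fact (1 < L)] [TopologicalSpace G] [IsTopologicalGroup G] [CompactSpace G]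
  [BorelSpace G] in
/-- **The reflection `Θ₀` in the lattice planes `t = 0, L/2` on configurations**, written as the
link-plane reflection of the unit time translate: on spatial links `(x, i) ↦ U(θ₀ x, i)`, on
time-like links `(x, 0) ↦ U(θ₀(x + e₀), 0)⁻¹`, with `θ₀ x = θ x - e₀ = (-x₀, x⃗)`. [folklore] -/
theorem siteReflect_apply (U : GaugeConfig d L G) (e : Edge d L) :
    (torusConfigShift (Pi.single (0 : Fin d) (1 : ZMod L)) U).timeReflect e =
      if e.2 = 0 then (U ((e.1.shift 0).timeReflect - Pi.single 0 1, 0))⁻¹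
      else U (e.1.timeReflect - Pi.single 0 1, e.2) := by
  rw [timeReflect_apply]
  unfold edgeReflect
  split_ifs with h
  · rw [torusConfigShift_apply]
  · rw [torusConfigShift_apply]

omit [NeZero L] [Fact (1 < L)] in
/-- Time coordinate of `θ₀ y`: it is `-y₀`. [folklore] -/
@[simp] theorem siteReflect_site_apply_zero (y : Site d L) :
    (y.timeReflect - Pi.single (0 : Fin d) (1 : ZMod L) : Site d L) 0 = -y 0 := by
  simp [Site.timeReflect]

omit [NeZero L] [Fact (1 < L)] in
/-- `θ₀` does not change the spatial coordinates. [folklore] -/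
theorem siteReflect_site_apply_of_ne (y : Site d L) {k : Fin d} (hk : k ≠ 0) :
    (y.timeReflect - Pi.single (0 : Fin d) (1 : ZMod L) : Site d L) k = y k := by
  simp [Site.timeReflect, hk]

omit [NeZero L] [Fact (1 < L)] in
/-- `θ₀(c + t e₀) = c - t e₀` for `c` in a reflection plane (`2c₀ = 0`). [folklore] -/
theorem siteReflect_add_single {c : Site d L} (hc : c 0 + c 0 = 0) (t : ZMod L) :
    ((c + Pi.single 0 t).timeReflect - Pi.single (0 : Fin d) (1 : ZMod L) : Site d L) =
      c + Pi.single 0 (-t) := by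
  funext k
  by_cases hk : k = 0
  · subst hk
    rw [siteReflect_site_apply_zero]
    simp only [Pi.add_apply, Pi.single_eq_same]
    linear_combination -hc
  · rw [siteReflect_site_apply_of_ne _ hk]
    simp [Pi.single_eq_of_ne hk]

omit [NeZero L] [Fact (1 < L)] in
/-- `θ₀(c + t e₀ + e₀) = c - (t + 1) e₀` for `c` in a reflection plane. [folklore] -/
theorem siteReflect_shift_add_single {c : Site d L} (hc : c 0 + c 0 = 0) (t : ZMod L) :
    (((c + Pi.single 0 t).shift 0).timeReflect - Pi.single (0 : Fin d) (1 : ZMod L) : Site d L) =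
      c + Pi.single 0 (-(t + 1)) := by
  have h : (c + Pi.single 0 t).shift 0 = c + Pi.single (0 : Fin d) (t + 1) := by
    simp only [Site.shift, add_assoc, ← Pi.single_add]
  rw [h, siteReflect_add_single hc]

omit [NeZero L] [Fact (1 < L)] in
/-- A spatially displaced point of a reflection plane lies in the plane. [folklore] -/
theorem add_single_apply_zero_add {c : Site d L} (hc : c 0 + c 0 = 0) {j : Fin d} (hj : j ≠ 0)
    (s : ZMod L) : (c + Pi.single j s : Site d L) 0 + (c + Pi.single j s : Site d L) 0 = 0 := by
  rw [apply_zero_add_single_of_ne _ hj]; exact hc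

omit [NeZero L] [Fact (1 < L)] [TopologicalSpace G] [IsTopologicalGroup G] [CompactSpace G] [BorelSpace G] in
/-- **The reflection carries the downward staple of `Θ₀U` to the upward staple of `U`**
(hypothesis `hUp` of `re_trace_rectangleHolonomy_eq_sum_down` for `R = Θ₀`), for a base point
`c` in a reflection plane and a spatial direction `j`. [folklore] -/
theorem upStaple_eq_downStaple_siteReflect (U : GaugeConfig d L G) {c : Site d L}
    (hc : c 0 + c 0 = 0) {j : Fin d} (hj : j ≠ 0) (a m : ℕ) :
    lineHolonomy U 0 (a + 1) c * lineHolonomy U j m (c + Pi.single 0 (((a + 1 : ℕ)) : ZMod L)) *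
        (lineHolonomy U 0 (a + 1) (c + Pi.single j ((m : ℕ) : ZMod L)))⁻¹ =
      (lineHolonomy (torusConfigShift (Pi.single (0 : Fin d) (1 : ZMod L)) U).timeReflect 0 (a + 1)
          (c + Pi.single 0 (-(((a + 1 : ℕ)) : ZMod L))))⁻¹ *
        lineHolonomy (torusConfigShift (Pi.single (0 : Fin d) (1 : ZMod L)) U).timeReflect j m
          (c + Pi.single 0 (-(((a + 1 : ℕ)) : ZMod L))) *
        lineHolonomy (torusConfigShift (Pi.single (0 : Fin d) (1 : ZMod L)) U).timeReflect 0 (a + 1)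
          (c + Pi.single 0 (-(((a + 1 : ℕ)) : ZMod L)) + Pi.single j ((m : ℕ) : ZMod L)) := by
  -- time-like legs: inverse of the mirror leg
  have hleg : ∀ c' : Site d L, c' 0 + c' 0 = 0 →
      lineHolonomy (torusConfigShift (Pi.single (0 : Fin d) (1 : ZMod L)) U).timeReflect 0 (a + 1)
        (c' + Pi.single 0 (-(((a + 1 : ℕ)) : ZMod L))) = (lineHolonomy U 0 (a + 1) c')⁻¹ := by
    intro c' hc'
    refine lineHolonomy_eq_inv_of_links _ _ 0 (a + 1) _ _ fun s hs => ?_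
    rw [siteReflect_apply]
    simp only [↓reduceIte]
    rw [add_single_add_single_same, siteReflect_shift_add_single hc']
    congr 4
    rw [Nat.cast_sub (by omega : s ≤ a + 1 - 1)]
    push_cast
    ring
  -- the bottom: the spatial line at the mirror height
  have hbot : lineHolonomy (torusConfigShift (Pi.single (0 : Fin d) (1 : ZMod L)) U).timeReflect j m
      (c + Pi.single 0 (-(((a + 1 : ℕ)) : ZMod L))) =
      lineHolonomy U j m (c + Pi.single 0 (((a + 1 : ℕ)) : ZMod L)) := by
    refine lineHolonomy_eq_of_links _ _ j m _ _ fun r _ => ?_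
    rw [siteReflect_apply]
    simp only [hj, ↓reduceIte]
    rw [add_single_add_single_comm c 0 j, add_single_add_single_comm c 0 j,
      siteReflect_add_single (add_single_apply_zero_add hc hj _), neg_neg]
  rw [hleg c hc, inv_inv, hbot, add_single_add_single_comm c 0 j,
    hleg _ (add_single_apply_zero_add hc hj _)]

omit [Fact (1 < L)] in
/-- **`Θ₀` preserves the product Haar measure** (a translation followed by the link-plane
reflection, both measure preserving). [folklore] -/
theorem measurePreserving_siteReflect :
    MeasurePreserving (fun U : GaugeConfig d L G =>
        (torusConfigShift (Pi.single (0 : Fin d) (1 : ZMod L)) U).timeReflect)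
      (LatticeRP.piMeasure (haarProbability G)) (LatticeRP.piMeasure (haarProbability G)) := by
  have hτ : MeasurePreserving (torusConfigShift (G := G) (Pi.single (0 : Fin d) (1 : ZMod L)))
      (LatticeRP.piMeasure (haarProbability G)) (LatticeRP.piMeasure (haarProbability G)) :=
    measurePreserving_arrowCongr' (fun _ : Edge d L => haarProbability G)
      (fun _ : Edge d L => haarProbability G) (torusEdgeShift (Pi.single (0 : Fin d) (1 : ZMod L)))
      (MeasurableEquiv.refl G) fun _ => MeasurePreserving.id _
  exact measurePreserving_timeReflect.comp hτ

end SiteReflection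


/-! ### Time coordinates under `θ₀` and the blocks `P₀`, `M₀` -/

section Blocks

omit [Fact (1 < L)] in
/-- Time coordinate of `θ₀ y` in `{0, …, L-1}`. [folklore] -/
theorem val_siteReflect (y : Site d L) :
    ((y.timeReflect - Pi.single (0 : Fin d) (1 : ZMod L) : Site d L) 0).val =
      if (y 0).val = 0 then 0 else L - (y 0).val := by
  rw [siteReflect_site_apply_zero, ZMod.neg_val]
  by_cases h : y 0 = 0
  · rw [if_pos h, if_pos (by rw [h, ZMod.val_zero])]
  · rw [if_neg h, if_neg (fun h' => h ((ZMod.val_eq_zero _).1 h'))]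

/-- Time coordinate of `θ₀ (y + e₀)` in `{0, …, L-1}`. [folklore] -/
theorem val_siteReflect_shift (y : Site d L) :
    (((y.shift 0).timeReflect - Pi.single (0 : Fin d) (1 : ZMod L) : Site d L) 0).val =
      if (y 0).val + 1 = L then 0 else L - (y 0).val - 1 := by
  rw [val_siteReflect, WilsonRP.val_shift_self]
  have := ZMod.val_lt (y 0)
  by_cases h : (y 0).val + 1 = L
  · rw [if_pos h, if_pos rfl, if_pos h]
  · rw [if_neg h, if_neg (by omega), if_neg h]
    omega

omit [Fact (1 < L)] [TopologicalSpace G] [IsTopologicalGroup G] [CompactSpace G] [BorelSpace G] in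
/-- **`Θ₀` fixes the links of the shared block `M₀`** (spatial links inside the reflection
planes). [folklore] -/
theorem siteReflect_apply_of_mem_M (hL : Even L) (U : GaugeConfig d L G) (e : Edge d L)
    (he : e ∈ (Finset.univ.filter fun e : Edge d L =>
      e.2 ≠ 0 ∧ ((e.1 0).val = 0 ∨ (e.1 0).val = L / 2))) :
    (torusConfigShift (Pi.single (0 : Fin d) (1 : ZMod L)) U).timeReflect e = U e := by
  obtain ⟨x, i⟩ := e
  simp only [Finset.mem_filter, Finset.mem_univ, true_and] at he
  obtain ⟨hi, ht⟩ := he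
  have h2 : x 0 + x 0 = 0 := two_mul_eq_zero_of_val hL ht
  have hx : (x.timeReflect - Pi.single (0 : Fin d) (1 : ZMod L) : Site d L) = x := by
    funext k
    by_cases hk : k = 0
    · subst hk
      rw [siteReflect_site_apply_zero]
      linear_combination -h2
    · exact siteReflect_site_apply_of_ne x hk
  rw [siteReflect_apply]
  simp only [hi, ↓reduceIte, hx]

omit [TopologicalSpace G] [IsTopologicalGroup G] [CompactSpace G] [BorelSpace G] in
/-- **The image under `Θ₀` of a link of `P₀` is determined off `P₀`** (hypothesis `hΘdep` of the
abstract mechanism): `(Θ₀U)_e` is a link variable of the reflected block. [folklore] -/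
theorem dependsOn_siteReflect_apply (hL : Even L) (e : Edge d L)
    (he : e ∈ (Finset.univ.filter fun e : Edge d L =>
        (e.1 0).val < L / 2 ∧ (e.2 = 0 ∨ 1 ≤ (e.1 0).val)) ∪ (∅ : Finset (Edge d L))) :
    DependsOn (fun U : GaugeConfig d L G =>
        (torusConfigShift (Pi.single (0 : Fin d) (1 : ZMod L)) U).timeReflect e)
      (((Finset.univ.filter fun e : Edge d L =>
        (e.1 0).val < L / 2 ∧ (e.2 = 0 ∨ 1 ≤ (e.1 0).val))ᶜ : Finset (Edge d L)) : Set (Edge d L)) := by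
  obtain ⟨x, i⟩ := e
  have h1L : 1 < L := Fact.out
  have hE := Nat.even_iff.mp hL
  have hlt := ZMod.val_lt (x 0)
  rw [Finset.union_empty, Finset.mem_filter] at he
  obtain ⟨-, ht, hi⟩ := he
  simp only at ht hi
  intro U V hUV
  simp only [siteReflect_apply]
  by_cases hi0 : i = 0
  · subst hi0
    simp only [↓reduceIte]
    rw [hUV _ ?_]
    rw [Finset.mem_coe, Finset.mem_compl, Finset.mem_filter]
    simp only [Finset.mem_univ, true_and, not_and]
    intro h
    rw [val_siteReflect_shift] at h
    split_ifs at h <;> omega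
  · simp only [hi0, ↓reduceIte]
    rw [hUV _ ?_]
    rw [Finset.mem_coe, Finset.mem_compl, Finset.mem_filter]
    simp only [Finset.mem_univ, true_and, not_and]
    intro h
    rw [val_siteReflect] at h
    rcases hi with hi | hi
    · exact absurd hi hi0
    · split_ifs at h <;> omega

omit [Fact (1 < L)] in
/-- The blocks `M₀` and `P₀` are disjoint. [folklore] -/
theorem disjoint_M_P :
    Disjoint (Finset.univ.filter fun e : Edge d L => e.2 ≠ 0 ∧ ((e.1 0).val = 0 ∨ (e.1 0).val = L / 2))
      (Finset.univ.filter fun e : Edge d L => (e.1 0).val < L / 2 ∧ (e.2 = 0 ∨ 1 ≤ (e.1 0).val)) := by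
  rw [Finset.disjoint_left]
  intro e hM hP
  rw [Finset.mem_filter] at hM hP
  obtain ⟨-, hi, ht⟩ := hM
  obtain ⟨-, hlt, hi'⟩ := hP
  rcases hi' with hi' | hi'
  · exact hi hi'
  · omega

end Blocks

/-! ### The plaquettes under `Θ₀` and the split of the action -/

section Plaquettes

omit [NeZero L] [Fact (1 < L)] in
/-- `θ₀` is an involution. [folklore] -/
theorem siteReflect_site_siteReflect_site (y : Site d L) :
    ((y.timeReflect - Pi.single (0 : Fin d) (1 : ZMod L) : Site d L).timeReflect -
        Pi.single (0 : Fin d) (1 : ZMod L) : Site d L) = y := by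
  funext k
  by_cases hk : k = 0
  · subst hk; rw [siteReflect_site_apply_zero, siteReflect_site_apply_zero, neg_neg]
  · rw [siteReflect_site_apply_of_ne _ hk, siteReflect_site_apply_of_ne _ hk]

omit [NeZero L] [Fact (1 < L)] in
/-- The reflection of time-like links is an involution: `θ₀(θ₀(y + e₀) + e₀) = y`. [folklore] -/
theorem siteReflect_site_shift_siteReflect_site_shift (y : Site d L) :
    ((((y.shift 0).timeReflect - Pi.single (0 : Fin d) (1 : ZMod L) : Site d L).shift 0).timeReflect -
        Pi.single (0 : Fin d) (1 : ZMod L) : Site d L) = y := by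
  funext k
  by_cases hk : k = 0
  · subst hk
    rw [siteReflect_site_apply_zero, WilsonRP.shift_apply_self, siteReflect_site_apply_zero,
      WilsonRP.shift_apply_self]
    ring
  · rw [siteReflect_site_apply_of_ne _ hk, WilsonRP.shift_apply_of_ne _ hk,
      siteReflect_site_apply_of_ne _ hk, WilsonRP.shift_apply_of_ne _ hk]

omit [NeZero L] [Fact (1 < L)] [MeasurableSpace G] [BorelSpace G] in
/-- **`Re tr ρ((Θ₀U)_p) = Re tr ρ(U_{ϑ₀ p})`**: the reflected plaquette variable is the variable of
the reflected plaquette `ϑ₀ p = (base of ϑp shifted by -e₀, same plane)`, `ϑ` being Wave 0's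
`WilsonRP.plaqReflect`. [folklore] -/
theorem plaqRe_siteReflect [MeasurableSpace G] (hρ : Continuous ρ) (U : GaugeConfig d L G)
    (p : Plaquette d L) :
    plaqRe ρ (torusConfigShift (Pi.single (0 : Fin d) (1 : ZMod L)) U).timeReflect p =
      plaqRe ρ U ((plaqReflect p).1 - Pi.single (0 : Fin d) (1 : ZMod L), p.2) := by
  rw [plaqRe_timeReflect ρ hρ]
  unfold plaqRe plaqReflect
  simp only [plaquetteHolonomy_torusConfigShift]

omit [NeZero L] [Fact (1 < L)] in
/-- The plaquette reflection `ϑ₀` is an involution. [folklore] -/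
theorem plaqSiteReflect_involutive :
    Function.Involutive (fun p : Plaquette d L =>
      (((plaqReflect p).1 - Pi.single (0 : Fin d) (1 : ZMod L) : Site d L), p.2)) := by
  intro p
  obtain ⟨x, ij⟩ := p
  unfold plaqReflect
  by_cases hi : ij.1.1 = 0
  · simp only [hi, ↓reduceIte, siteReflect_site_shift_siteReflect_site_shift]
  · simp only [hi, ↓reduceIte, siteReflect_site_siteReflect_site]

/-- Time coordinate of the base point of `ϑ₀ p` for a time-like plaquette. [folklore] -/
theorem val_plaqSiteReflect_of_eq {p : Plaquette d L} (hi : p.2.1.1 = 0) :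
    (((plaqReflect p).1 - Pi.single (0 : Fin d) (1 : ZMod L) : Site d L) 0).val =
      if (p.1 0).val + 1 = L then 0 else L - (p.1 0).val - 1 := by
  unfold plaqReflect
  rw [if_pos hi]
  exact val_siteReflect_shift p.1

omit [Fact (1 < L)] in
/-- Time coordinate of the base point of `ϑ₀ p` for a spatial plaquette. [folklore] -/
theorem val_plaqSiteReflect_of_ne {p : Plaquette d L} (hi : p.2.1.1 ≠ 0) :
    (((plaqReflect p).1 - Pi.single (0 : Fin d) (1 : ZMod L) : Site d L) 0).val =
      if (p.1 0).val = 0 then 0 else L - (p.1 0).val := by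
  unfold plaqReflect
  rw [if_neg hi]
  exact val_siteReflect p.1

/-- `ϑ₀` maps positive plaquettes to negative ones (`pos p :↔ t(p) < L/2 ∧ (p time-like ∨ 1 ≤ t(p))`,
`Mpl p :↔ p spatial ∧ t(p) ∈ {0, L/2}`, `neg = ¬pos ∧ ¬Mpl`). [folklore] -/
theorem neg_plaqSiteReflect_of_pos (hL : Even L) {p : Plaquette d L}
    (hp : (p.1 0).val < L / 2 ∧ (p.2.1.1 = 0 ∨ 1 ≤ (p.1 0).val)) :
    ¬ ((((plaqReflect p).1 - Pi.single (0 : Fin d) (1 : ZMod L) : Site d L) 0).val < L / 2 ∧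
        (p.2.1.1 = 0 ∨ 1 ≤ (((plaqReflect p).1 - Pi.single (0 : Fin d) (1 : ZMod L) : Site d L) 0).val)) ∧
      ¬ (p.2.1.1 ≠ 0 ∧ ((((plaqReflect p).1 - Pi.single (0 : Fin d) (1 : ZMod L) : Site d L) 0).val = 0 ∨
        (((plaqReflect p).1 - Pi.single (0 : Fin d) (1 : ZMod L) : Site d L) 0).val = L / 2)) := by
  have h1L : 1 < L := Fact.out
  have hE := Nat.even_iff.mp hL
  have hlt := ZMod.val_lt (p.1 0)
  obtain ⟨ht, hi⟩ := hp
  by_cases hi0 : p.2.1.1 = 0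
  · rw [val_plaqSiteReflect_of_eq hi0]
    by_cases h : (p.1 0).val + 1 = L
    · rw [if_pos h]; omega
    · rw [if_neg h]
      refine ⟨fun h' => ?_, fun h' => h'.1 hi0⟩
      omega
  · rcases hi with hi | hi
    · exact absurd hi hi0
    rw [val_plaqSiteReflect_of_ne hi0]
    rw [if_neg (by omega)]
    refine ⟨fun h' => ?_, fun h' => ?_⟩
    · omega
    · rcases h'.2 with h'' | h'' <;> omega

/-- `ϑ₀` maps negative plaquettes to positive ones. [folklore] -/
theorem pos_plaqSiteReflect_of_neg (hL : Even L) {p : Plaquette d L}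
    (hp : ¬ ((p.1 0).val < L / 2 ∧ (p.2.1.1 = 0 ∨ 1 ≤ (p.1 0).val)) ∧
      ¬ (p.2.1.1 ≠ 0 ∧ ((p.1 0).val = 0 ∨ (p.1 0).val = L / 2))) :
    (((plaqReflect p).1 - Pi.single (0 : Fin d) (1 : ZMod L) : Site d L) 0).val < L / 2 ∧
      (p.2.1.1 = 0 ∨ 1 ≤ (((plaqReflect p).1 - Pi.single (0 : Fin d) (1 : ZMod L) : Site d L) 0).val) := by
  have h1L : 1 < L := Fact.out
  have hE := Nat.even_iff.mp hL
  have hlt := ZMod.val_lt (p.1 0)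
  obtain ⟨hnp, hnm⟩ := hp
  by_cases hi0 : p.2.1.1 = 0
  · rw [val_plaqSiteReflect_of_eq hi0]
    have ht : ¬ (p.1 0).val < L / 2 := fun h => hnp ⟨h, Or.inl hi0⟩
    by_cases h : (p.1 0).val + 1 = L
    · rw [if_pos h]; exact ⟨by omega, Or.inl hi0⟩
    · rw [if_neg h]; exact ⟨by omega, Or.inl hi0⟩
  · rw [val_plaqSiteReflect_of_ne hi0]
    have h0 : (p.1 0).val ≠ 0 := fun h => hnm ⟨hi0, Or.inl h⟩
    have h2 : (p.1 0).val ≠ L / 2 := fun h => hnm ⟨hi0, Or.inr h⟩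
    have ht : ¬ (p.1 0).val < L / 2 := fun h => hnp ⟨h, Or.inr (by omega)⟩
    rw [if_neg h0]
    exact ⟨by omega, Or.inr (by omega)⟩

omit [MeasurableSpace G] [BorelSpace G] in
set_option maxHeartbeats 1600000 in
/-- **The negative part of the action is the positive part of the reflected configuration**:
`∑_{neg} Re tr ρ(U_p) = ∑_{pos} Re tr ρ((Θ₀U)_p)`, by the bijection `ϑ₀` between positive and
negative plaquettes. [folklore] -/
theorem sum_neg_eq_sum_pos_siteReflect [MeasurableSpace G] (hL : Even L) (hρ : Continuous ρ)
    (U : GaugeConfig d L G) :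
    ∑ p ∈ Finset.univ.filter (fun p : Plaquette d L =>
        ¬ ((p.1 0).val < L / 2 ∧ (p.2.1.1 = 0 ∨ 1 ≤ (p.1 0).val)) ∧
        ¬ (p.2.1.1 ≠ 0 ∧ ((p.1 0).val = 0 ∨ (p.1 0).val = L / 2))), plaqRe ρ U p =
      ∑ p ∈ Finset.univ.filter (fun p : Plaquette d L =>
        (p.1 0).val < L / 2 ∧ (p.2.1.1 = 0 ∨ 1 ≤ (p.1 0).val)),
        plaqRe ρ (torusConfigShift (Pi.single (0 : Fin d) (1 : ZMod L)) U).timeReflect p := by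
  have hinv := plaqSiteReflect_involutive (d := d) (L := L)
  refine Finset.sum_nbij'
    (fun p : Plaquette d L => (((plaqReflect p).1 - Pi.single (0 : Fin d) (1 : ZMod L) : Site d L), p.2))
    (fun p : Plaquette d L => (((plaqReflect p).1 - Pi.single (0 : Fin d) (1 : ZMod L) : Site d L), p.2))
    (fun p hp => ?_) (fun p hp => ?_) (fun p _ => hinv p) (fun p _ => hinv p) (fun p _ => ?_)
  · rw [Finset.mem_filter] at hp ⊢
    exact ⟨Finset.mem_univ _, pos_plaqSiteReflect_of_neg hL hp.2⟩
  · rw [Finset.mem_filter] at hp ⊢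
    exact ⟨Finset.mem_univ _, neg_plaqSiteReflect_of_pos hL hp.2⟩
  · have h := hinv p
    simp only at h
    rw [plaqRe_siteReflect ρ hρ]
    simp only
    rw [h]

omit [NeZero L] [Fact (1 < L)] in
/-- Plaquettes of the shared planes are not positive. [folklore] -/
theorem not_pos_of_Mpl (p : Plaquette d L)
    (h : p.2.1.1 ≠ 0 ∧ ((p.1 0).val = 0 ∨ (p.1 0).val = L / 2)) :
    ¬ ((p.1 0).val < L / 2 ∧ (p.2.1.1 = 0 ∨ 1 ≤ (p.1 0).val)) := by
  obtain ⟨hi, ht⟩ := h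
  rintro ⟨hlt, hi' | hi'⟩
  · exact hi hi'
  · omega

omit [MeasurableSpace G] [BorelSpace G] in
/-- **Split of the action relative to the lattice planes**:
`∑ₚ Re tr ρ(U_p) = A₀(U) + A₀(Θ₀U) + A_M(U)` with `A₀` the sum over positive plaquettes and
`A_M` the sum over the spatial plaquettes inside the planes `t = 0, L/2`. [folklore] -/
theorem sum_plaqRe_eq_site [MeasurableSpace G] (hL : Even L) (hρ : Continuous ρ) (U : GaugeConfig d L G) :
    ∑ p, plaqRe ρ U p =
      (∑ p ∈ Finset.univ.filter (fun p : Plaquette d L =>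
          (p.1 0).val < L / 2 ∧ (p.2.1.1 = 0 ∨ 1 ≤ (p.1 0).val)), plaqRe ρ U p) +
      (∑ p ∈ Finset.univ.filter (fun p : Plaquette d L =>
          (p.1 0).val < L / 2 ∧ (p.2.1.1 = 0 ∨ 1 ≤ (p.1 0).val)),
          plaqRe ρ (torusConfigShift (Pi.single (0 : Fin d) (1 : ZMod L)) U).timeReflect p) +
      (∑ p ∈ Finset.univ.filter (fun p : Plaquette d L =>
          p.2.1.1 ≠ 0 ∧ ((p.1 0).val = 0 ∨ (p.1 0).val = L / 2)), plaqRe ρ U p) := by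
  rw [← Finset.sum_filter_add_sum_filter_not Finset.univ
      (fun p : Plaquette d L => (p.1 0).val < L / 2 ∧ (p.2.1.1 = 0 ∨ 1 ≤ (p.1 0).val)),
    ← Finset.sum_filter_add_sum_filter_not
      (Finset.univ.filter fun p : Plaquette d L => ¬ ((p.1 0).val < L / 2 ∧ (p.2.1.1 = 0 ∨ 1 ≤ (p.1 0).val)))
      (fun p : Plaquette d L => p.2.1.1 ≠ 0 ∧ ((p.1 0).val = 0 ∨ (p.1 0).val = L / 2)),
    Finset.filter_filter, Finset.filter_filter, ← sum_neg_eq_sum_pos_siteReflect ρ hL hρ U]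
  have hM : (Finset.univ.filter fun p : Plaquette d L =>
      ¬ ((p.1 0).val < L / 2 ∧ (p.2.1.1 = 0 ∨ 1 ≤ (p.1 0).val)) ∧
        (p.2.1.1 ≠ 0 ∧ ((p.1 0).val = 0 ∨ (p.1 0).val = L / 2))) =
      Finset.univ.filter fun p : Plaquette d L =>
        p.2.1.1 ≠ 0 ∧ ((p.1 0).val = 0 ∨ (p.1 0).val = L / 2) :=
    Finset.filter_congr fun p _ => ⟨fun h => h.2, fun h => ⟨not_pos_of_Mpl p h, h⟩⟩
  rw [hM]
  ring

omit [MeasurableSpace G] [BorelSpace G] in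
/-- **`S = N·#plaquettes - A₀ - A₀ ∘ Θ₀ - A_M`.** [folklore] -/
theorem wilsonAction_split_site [MeasurableSpace G] (hL : Even L) (hρ : Continuous ρ)
    (U : GaugeConfig d L G) :
    wilsonAction ρ U = N * Fintype.card (Plaquette d L) -
      ((∑ p ∈ Finset.univ.filter (fun p : Plaquette d L =>
          (p.1 0).val < L / 2 ∧ (p.2.1.1 = 0 ∨ 1 ≤ (p.1 0).val)), plaqRe ρ U p) +
      (∑ p ∈ Finset.univ.filter (fun p : Plaquette d L =>
          (p.1 0).val < L / 2 ∧ (p.2.1.1 = 0 ∨ 1 ≤ (p.1 0).val)),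
          plaqRe ρ (torusConfigShift (Pi.single (0 : Fin d) (1 : ZMod L)) U).timeReflect p) +
      (∑ p ∈ Finset.univ.filter (fun p : Plaquette d L =>
          p.2.1.1 ≠ 0 ∧ ((p.1 0).val = 0 ∨ (p.1 0).val = L / 2)), plaqRe ρ U p)) := by
  rw [wilsonAction_eq, sum_plaqRe_eq_site ρ hL hρ]

omit [NeZero d] [Fact (1 < L)] [MeasurableSpace G] [BorelSpace G] in
/-- A sum of plaquette variables over a set of plaquettes is bounded by `N · #plaquettes`.
[folklore] -/
theorem abs_sum_plaqRe_le (hρ : Continuous ρ) (s : Finset (Plaquette d L))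
    (U : GaugeConfig d L G) : |∑ p ∈ s, plaqRe ρ U p| ≤ N * Fintype.card (Plaquette d L) := by
  calc |∑ p ∈ s, plaqRe ρ U p| ≤ ∑ p ∈ s, |plaqRe ρ U p| := Finset.abs_sum_le_sum_abs _ _
    _ ≤ ∑ _p ∈ s, (N : ℝ) := Finset.sum_le_sum fun p _ => abs_plaqRe_le ρ hρ U p
    _ ≤ ∑ _p : Plaquette d L, (N : ℝ) :=
        Finset.sum_le_sum_of_subset_of_nonneg (Finset.subset_univ _) fun _ _ _ => Nat.cast_nonneg _
    _ = N * Fintype.card (Plaquette d L) := by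
        rw [Finset.sum_const, Finset.card_univ, nsmul_eq_mul, mul_comm]

omit [TopologicalSpace G] [IsTopologicalGroup G] [CompactSpace G] [MeasurableSpace G] [BorelSpace G] in
/-- **The positive part `A₀` depends only on the links of `P₀ ∪ M₀`.** [folklore] -/
theorem dependsOn_sumPos (U V : GaugeConfig d L G)
    (hUV : ∀ e ∈ (((Finset.univ.filter fun e : Edge d L =>
        (e.1 0).val < L / 2 ∧ (e.2 = 0 ∨ 1 ≤ (e.1 0).val)) ∪ ∅ ∪
        (Finset.univ.filter fun e : Edge d L => e.2 ≠ 0 ∧ ((e.1 0).val = 0 ∨ (e.1 0).val = L / 2))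
          : Finset (Edge d L)) : Set (Edge d L)), U e = V e) :
    ∑ p ∈ Finset.univ.filter (fun p : Plaquette d L =>
        (p.1 0).val < L / 2 ∧ (p.2.1.1 = 0 ∨ 1 ≤ (p.1 0).val)), plaqRe ρ U p =
      ∑ p ∈ Finset.univ.filter (fun p : Plaquette d L =>
        (p.1 0).val < L / 2 ∧ (p.2.1.1 = 0 ∨ 1 ≤ (p.1 0).val)), plaqRe ρ V p := by
  have h1L : 1 < L := Fact.out
  -- a link with time coordinate `t` is in `P₀ ∪ M₀` if `t < L/2`, or `t = L/2` and spatial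
  have hmem : ∀ (y : Site d L) (i : Fin d), ((y 0).val < L / 2 ∨ ((y 0).val = L / 2 ∧ i ≠ 0)) →
      U (y, i) = V (y, i) := by
    intro y i hy
    apply hUV
    rw [Finset.union_empty, Finset.coe_union, Set.mem_union, Finset.mem_coe, Finset.mem_coe,
      Finset.mem_filter, Finset.mem_filter]
    simp only [Finset.mem_univ, true_and]
    by_cases hi : i = 0
    · left; exact ⟨by omega, Or.inl hi⟩
    · rcases hy with hy | hy
      · by_cases h0 : (y 0).val = 0
        · right; exact ⟨hi, Or.inl h0⟩
        · left; exact ⟨hy, Or.inr (by omega)⟩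
      · right; exact ⟨hi, Or.inr hy.1⟩
  refine Finset.sum_congr rfl fun p hp => ?_
  rw [Finset.mem_filter] at hp
  obtain ⟨-, ht, hi⟩ := hp
  obtain ⟨x, ⟨⟨i, j⟩, hij⟩⟩ := p
  have hj : j ≠ 0 := plaq_snd_ne_zero (x, ⟨(i, j), hij⟩)
  simp only at ht hi hj
  unfold plaqRe plaquetteHolonomy
  simp only
  have hxj : ((x.shift j) 0).val = (x 0).val := val_shift_of_ne x (Ne.symm hj)
  by_cases hi0 : i = 0
  · subst hi0
    have hxi : ((x.shift 0) 0).val = (x 0).val + 1 := by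
      rw [WilsonRP.val_shift_self]; rw [if_neg (by omega)]
    rw [hmem x 0 (Or.inl ht), hmem (x.shift 0) j (by
        rw [hxi]; exact if h : (x 0).val + 1 < L / 2 then Or.inl h else Or.inr ⟨by omega, hj⟩),
      hmem (x.shift j) 0 (Or.inl (by rw [hxj]; exact ht)), hmem x j (Or.inl ht)]
  · rcases hi with hi | hi
    · exact absurd hi hi0
    · have hxi : ((x.shift i) 0).val = (x 0).val := val_shift_of_ne x (Ne.symm hi0)
      rw [hmem x i (Or.inl ht), hmem (x.shift i) j (Or.inl (by rw [hxi]; exact ht)),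
        hmem (x.shift j) i (Or.inl (by rw [hxj]; exact ht)), hmem x j (Or.inl ht)]

omit [Fact (1 < L)] [TopologicalSpace G] [IsTopologicalGroup G] [CompactSpace G] [MeasurableSpace G]
  [BorelSpace G] in
/-- **The shared part `A_M` depends only on the links of `M₀`** (stated for `P₀ ∪ ∅ ∪ M₀` and
for `M₀`-agreement separately below). [folklore] -/
theorem dependsOn_sumM (U V : GaugeConfig d L G)
    (hUV : ∀ e ∈ ((Finset.univ.filter fun e : Edge d L =>
        e.2 ≠ 0 ∧ ((e.1 0).val = 0 ∨ (e.1 0).val = L / 2)) : Set (Edge d L)), U e = V e) :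
    ∑ p ∈ Finset.univ.filter (fun p : Plaquette d L =>
        p.2.1.1 ≠ 0 ∧ ((p.1 0).val = 0 ∨ (p.1 0).val = L / 2)), plaqRe ρ U p =
      ∑ p ∈ Finset.univ.filter (fun p : Plaquette d L =>
        p.2.1.1 ≠ 0 ∧ ((p.1 0).val = 0 ∨ (p.1 0).val = L / 2)), plaqRe ρ V p := by
  have hmem : ∀ (y : Site d L) (i : Fin d), i ≠ 0 → ((y 0).val = 0 ∨ (y 0).val = L / 2) →
      U (y, i) = V (y, i) := fun y i hi hy => hUV _ (by
    rw [Finset.mem_coe, Finset.mem_filter]; exact ⟨Finset.mem_univ _, hi, hy⟩)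
  refine Finset.sum_congr rfl fun p hp => ?_
  rw [Finset.mem_filter] at hp
  obtain ⟨-, hi, ht⟩ := hp
  obtain ⟨x, ⟨⟨i, j⟩, hij⟩⟩ := p
  have hj : j ≠ 0 := plaq_snd_ne_zero (x, ⟨(i, j), hij⟩)
  simp only at ht hi hj
  unfold plaqRe plaquetteHolonomy
  simp only
  have hxj : ((x.shift j) 0).val = (x 0).val := val_shift_of_ne x (Ne.symm hj)
  have hxi : ((x.shift i) 0).val = (x 0).val := val_shift_of_ne x (Ne.symm hi)
  rw [hmem x i hi ht, hmem (x.shift i) j hj (by rw [hxi]; exact ht),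
    hmem (x.shift j) i hi (by rw [hxj]; exact ht), hmem x j hj ht]

omit [Fact (1 < L)] [TopologicalSpace G] [IsTopologicalGroup G] [CompactSpace G] [BorelSpace G] in
/-- **`A_M` is reflection invariant**: `A_M(Θ₀U) = A_M(U)`. [folklore] -/
theorem sumM_siteReflect (hL : Even L) (U : GaugeConfig d L G) :
    ∑ p ∈ Finset.univ.filter (fun p : Plaquette d L =>
        p.2.1.1 ≠ 0 ∧ ((p.1 0).val = 0 ∨ (p.1 0).val = L / 2)),
        plaqRe ρ (torusConfigShift (Pi.single (0 : Fin d) (1 : ZMod L)) U).timeReflect p =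
      ∑ p ∈ Finset.univ.filter (fun p : Plaquette d L =>
        p.2.1.1 ≠ 0 ∧ ((p.1 0).val = 0 ∨ (p.1 0).val = L / 2)), plaqRe ρ U p :=
  dependsOn_sumM ρ _ _ fun e he => siteReflect_apply_of_mem_M hL U e he

end Plaquettes


/-! ### The downward staples of the loop lie in `P₀` -/

section StapleEdges

local notation "P₀S" => (Finset.univ.filter fun e : Edge d L =>
  ZMod.val (Prod.fst e 0) < L / 2 ∧ (Prod.snd e = 0 ∨ 1 ≤ ZMod.val (Prod.fst e 0)))
local notation "M₀S" => (Finset.univ.filter fun e : Edge d L =>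
  Prod.snd e ≠ 0 ∧ (ZMod.val (Prod.fst e 0) = 0 ∨ ZMod.val (Prod.fst e 0) = L / 2))

variable {j : Fin d}

omit [NeZero L] in
/-- Time coordinate of the points of a downward staple hanging from the plane `t = L/2`:
`t(c - h e₀ + s e₀ + r eⱼ) = L/2 - h + s` for `s ≤ h ≤ L/2`. [folklore] -/
theorem val_downStaple_site (hj : j ≠ 0) {h s : ℕ} (hs : s ≤ h) (hh : h ≤ L / 2) (r : ZMod L) :
    (((0 : Site d L) + Pi.single 0 (((L / 2 : ℕ)) : ZMod L) + Pi.single 0 (-((h : ℕ) : ZMod L)) +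
        Pi.single j r + Pi.single 0 ((s : ℕ) : ZMod L) : Site d L) 0).val = L / 2 - h + s := by
  have h1L : 1 < L := Fact.out
  have hL2 : L / 2 < L := Nat.div_lt_self (by omega) one_lt_two
  simp only [Pi.add_apply, Pi.single_eq_same, Pi.single_eq_of_ne (Ne.symm hj),
    zero_add, add_zero]
  rw [show (((L / 2 : ℕ)) : ZMod L) + -((h : ℕ) : ZMod L) + ((s : ℕ) : ZMod L) =
      (((L / 2 - h + s : ℕ)) : ZMod L) by push_cast [Nat.cast_sub hh]; ring,
    ZMod.val_cast_of_lt (by omega)]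

omit [TopologicalSpace G] [IsTopologicalGroup G] [CompactSpace G] [MeasurableSpace G] [BorelSpace G] in
/-- **The downward staple of height `h` hanging from the plane `t = L/2` depends only on the links
of `P₀`** (`1 ≤ h`, `h + 1 ≤ L/2`), stated for `P₀ ∪ ∅ ∪ M₀`-agreement. [folklore] -/
theorem downStaple_congr (hj : j ≠ 0) {h : ℕ} (h1 : 1 ≤ h) (hh : h + 1 ≤ L / 2) (m : ℕ)
    {V V' : GaugeConfig d L G}
    (hVV' : ∀ e ∈ (((P₀S) ∪ ∅ ∪ (M₀S) : Finset (Edge d L)) : Set (Edge d L)), V e = V' e) :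
    (lineHolonomy V 0 h ((0 : Site d L) + Pi.single 0 (((L / 2 : ℕ)) : ZMod L) +
        Pi.single 0 (-((h : ℕ) : ZMod L))))⁻¹ *
      lineHolonomy V j m ((0 : Site d L) + Pi.single 0 (((L / 2 : ℕ)) : ZMod L) +
        Pi.single 0 (-((h : ℕ) : ZMod L))) *
      lineHolonomy V 0 h ((0 : Site d L) + Pi.single 0 (((L / 2 : ℕ)) : ZMod L) +
        Pi.single 0 (-((h : ℕ) : ZMod L)) + Pi.single j ((m : ℕ) : ZMod L)) =
    (lineHolonomy V' 0 h ((0 : Site d L) + Pi.single 0 (((L / 2 : ℕ)) : ZMod L) +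
        Pi.single 0 (-((h : ℕ) : ZMod L))))⁻¹ *
      lineHolonomy V' j m ((0 : Site d L) + Pi.single 0 (((L / 2 : ℕ)) : ZMod L) +
        Pi.single 0 (-((h : ℕ) : ZMod L))) *
      lineHolonomy V' 0 h ((0 : Site d L) + Pi.single 0 (((L / 2 : ℕ)) : ZMod L) +
        Pi.single 0 (-((h : ℕ) : ZMod L)) + Pi.single j ((m : ℕ) : ZMod L)) := by
  have hP : ∀ (y : Site d L) (i : Fin d), (y 0).val < L / 2 → (i = 0 ∨ 1 ≤ (y 0).val) →
      V (y, i) = V' (y, i) := by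
    intro y i hy hi
    apply hVV'
    rw [Finset.union_empty, Finset.coe_union, Set.mem_union, Finset.mem_coe, Finset.mem_filter]
    exact Or.inl ⟨Finset.mem_univ _, hy, hi⟩
  -- the two legs
  have hleg : ∀ r : ZMod L, lineHolonomy V 0 h ((0 : Site d L) + Pi.single 0 (((L / 2 : ℕ)) : ZMod L) +
      Pi.single 0 (-((h : ℕ) : ZMod L)) + Pi.single j r) =
      lineHolonomy V' 0 h ((0 : Site d L) + Pi.single 0 (((L / 2 : ℕ)) : ZMod L) +
      Pi.single 0 (-((h : ℕ) : ZMod L)) + Pi.single j r) := by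
    intro r
    refine lineHolonomy_congr 0 h _ fun s hs => hP _ _ ?_ (Or.inl rfl)
    rw [val_downStaple_site hj hs.le (by omega)]
    omega
  have hleg0 := hleg 0
  simp only [Pi.single_zero, add_zero] at hleg0
  -- the bottom
  have hbot : lineHolonomy V j m ((0 : Site d L) + Pi.single 0 (((L / 2 : ℕ)) : ZMod L) +
      Pi.single 0 (-((h : ℕ) : ZMod L))) =
      lineHolonomy V' j m ((0 : Site d L) + Pi.single 0 (((L / 2 : ℕ)) : ZMod L) +
      Pi.single 0 (-((h : ℕ) : ZMod L))) := by
    refine lineHolonomy_congr j m _ fun r _ => ?_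
    have hv := val_downStaple_site (d := d) hj (le_refl 0 |>.trans (Nat.zero_le h)) (by omega : h ≤ L / 2) ((r : ℕ) : ZMod L)
    simp only [Nat.cast_zero, Pi.single_zero, add_zero] at hv
    exact hP _ _ (by rw [hv]; omega) (Or.inr (by rw [hv]; omega))
  rw [hleg0, hbot, hleg]

end StapleEdges


/-! ### The loop integral and the reflection-positive form for the lattice planes -/

section Form

local notation "P₀S" => (Finset.univ.filter fun e : Edge d L =>
  ZMod.val (Prod.fst e 0) < L / 2 ∧ (Prod.snd e = 0 ∨ 1 ≤ ZMod.val (Prod.fst e 0)))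
local notation "M₀S" => (Finset.univ.filter fun e : Edge d L =>
  Prod.snd e ≠ 0 ∧ (ZMod.val (Prod.fst e 0) = 0 ∨ ZMod.val (Prod.fst e 0) = L / 2))
local notation "PosP" => (Finset.univ.filter fun p : Plaquette d L =>
  ZMod.val (Prod.fst p 0) < L / 2 ∧ (Prod.fst (Subtype.val (Prod.snd p)) = 0 ∨ 1 ≤ ZMod.val (Prod.fst p 0)))
local notation "MP" => (Finset.univ.filter fun p : Plaquette d L =>
  Prod.fst (Subtype.val (Prod.snd p)) ≠ 0 ∧ (ZMod.val (Prod.fst p 0) = 0 ∨ ZMod.val (Prod.fst p 0) = L / 2))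

variable {j : Fin d}

omit [Fact (1 < L)] in
/-- The observable `g^h_{kl} = σ(S_h)_{kl} · e^{β(A₀ + A_M/2)}` (entry of the unitarised downward
staple times the positive-side Boltzmann factor) is measurable. [folklore] -/
theorem measurable_gSite (hρ : Continuous ρ) (β : ℝ) (h m : ℕ) (k l : Fin N) :
    Measurable fun U : GaugeConfig d L G =>
      CompactGroup.unitarize ρ hρ
          ((lineHolonomy U 0 h ((0 : Site d L) + Pi.single 0 (((L / 2 : ℕ)) : ZMod L) +
              Pi.single 0 (-((h : ℕ) : ZMod L))))⁻¹ *
            lineHolonomy U j m ((0 : Site d L) + Pi.single 0 (((L / 2 : ℕ)) : ZMod L) +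
              Pi.single 0 (-((h : ℕ) : ZMod L))) *
            lineHolonomy U 0 h ((0 : Site d L) + Pi.single 0 (((L / 2 : ℕ)) : ZMod L) +
              Pi.single 0 (-((h : ℕ) : ZMod L)) + Pi.single j ((m : ℕ) : ZMod L))) k l *
        ((Real.exp (β * ((∑ p ∈ PosP, plaqRe ρ U p) + (∑ p ∈ MP, plaqRe ρ U p) / 2)) : ℝ) : ℂ) := by
  have hσ := CompactGroup.continuous_unitarize ρ hρ
  refine ((((entryMeasurable_lineHolonomy_inv hσ 0 h _).mul (entryMeasurable_lineHolonomy hσ j m _)).mul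
    (entryMeasurable_lineHolonomy hσ 0 h _)) k l).mul (Complex.measurable_ofReal.comp ?_)
  exact (((Finset.measurable_sum _ fun p _ => measurable_plaqRe ρ hρ p).add
    ((Finset.measurable_sum _ fun p _ => measurable_plaqRe ρ hρ p).div_const _)).const_mul β).exp

omit [Fact (1 < L)] [MeasurableSpace G] [BorelSpace G] in
/-- The observable `g^h_{kl}` is bounded by `e^{2|β| N #plaquettes}`. [folklore] -/
theorem norm_gSite_le [MeasurableSpace G] (hρ : Continuous ρ) (β : ℝ) (h m : ℕ) (k l : Fin N)
    (U : GaugeConfig d L G) :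
    ‖CompactGroup.unitarize ρ hρ
          ((lineHolonomy U 0 h ((0 : Site d L) + Pi.single 0 (((L / 2 : ℕ)) : ZMod L) +
              Pi.single 0 (-((h : ℕ) : ZMod L))))⁻¹ *
            lineHolonomy U j m ((0 : Site d L) + Pi.single 0 (((L / 2 : ℕ)) : ZMod L) +
              Pi.single 0 (-((h : ℕ) : ZMod L))) *
            lineHolonomy U 0 h ((0 : Site d L) + Pi.single 0 (((L / 2 : ℕ)) : ZMod L) +
              Pi.single 0 (-((h : ℕ) : ZMod L)) + Pi.single j ((m : ℕ) : ZMod L))) k l *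
        ((Real.exp (β * ((∑ p ∈ PosP, plaqRe ρ U p) + (∑ p ∈ MP, plaqRe ρ U p) / 2)) : ℝ) : ℂ)‖ ≤
      Real.exp (|β| * (2 * (N * Fintype.card (Plaquette d L)))) := by
  rw [norm_mul, Complex.norm_real, Real.norm_eq_abs, abs_of_pos (Real.exp_pos _)]
  have h1 := CompactGroup.norm_unitarize_apply_le_one ρ hρ
    ((lineHolonomy U 0 h ((0 : Site d L) + Pi.single 0 (((L / 2 : ℕ)) : ZMod L) +
        Pi.single 0 (-((h : ℕ) : ZMod L))))⁻¹ *
      lineHolonomy U j m ((0 : Site d L) + Pi.single 0 (((L / 2 : ℕ)) : ZMod L) +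
        Pi.single 0 (-((h : ℕ) : ZMod L))) *
      lineHolonomy U 0 h ((0 : Site d L) + Pi.single 0 (((L / 2 : ℕ)) : ZMod L) +
        Pi.single 0 (-((h : ℕ) : ZMod L)) + Pi.single j ((m : ℕ) : ZMod L))) k l
  have hA := abs_sum_plaqRe_le ρ hρ (PosP) U
  have hM := abs_sum_plaqRe_le ρ hρ (MP) U
  calc _ ≤ 1 * Real.exp (|β| * (2 * (N * Fintype.card (Plaquette d L)))) :=
        mul_le_mul h1 (Real.exp_le_exp.2 ?_) (Real.exp_pos _).le zero_le_one
    _ = _ := one_mul _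
  calc β * ((∑ p ∈ PosP, plaqRe ρ U p) + (∑ p ∈ MP, plaqRe ρ U p) / 2)
      ≤ |β * ((∑ p ∈ PosP, plaqRe ρ U p) + (∑ p ∈ MP, plaqRe ρ U p) / 2)| := le_abs_self _
    _ = |β| * |(∑ p ∈ PosP, plaqRe ρ U p) + (∑ p ∈ MP, plaqRe ρ U p) / 2| := abs_mul _ _
    _ ≤ |β| * (2 * (N * Fintype.card (Plaquette d L))) := by
        refine mul_le_mul_of_nonneg_left ?_ (abs_nonneg _)
        calc |(∑ p ∈ PosP, plaqRe ρ U p) + (∑ p ∈ MP, plaqRe ρ U p) / 2|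
            ≤ |∑ p ∈ PosP, plaqRe ρ U p| + |(∑ p ∈ MP, plaqRe ρ U p) / 2| := abs_add_le _ _
          _ ≤ N * Fintype.card (Plaquette d L) + N * Fintype.card (Plaquette d L) := by
              rw [abs_div, abs_two]
              exact add_le_add hA (by linarith [hM, abs_nonneg (∑ p ∈ MP, plaqRe ρ U p)])
          _ = 2 * (N * Fintype.card (Plaquette d L)) := by ring

omit [TopologicalSpace G] [IsTopologicalGroup G] [CompactSpace G] [MeasurableSpace G] [BorelSpace G] in
/-- The positive-side Boltzmann factor `e^{β(A₀ + A_M/2)}` depends only on `P₀ ∪ ∅ ∪ M₀`.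
[folklore] -/
theorem weightSite_congr (β : ℝ) {U V : GaugeConfig d L G}
    (hUV : ∀ e ∈ (((P₀S) ∪ ∅ ∪ (M₀S) : Finset (Edge d L)) : Set (Edge d L)), U e = V e) :
    Real.exp (β * ((∑ p ∈ PosP, plaqRe ρ U p) + (∑ p ∈ MP, plaqRe ρ U p) / 2)) =
      Real.exp (β * ((∑ p ∈ PosP, plaqRe ρ V p) + (∑ p ∈ MP, plaqRe ρ V p) / 2)) := by
  rw [dependsOn_sumPos ρ U V hUV, dependsOn_sumM ρ U V fun e he => hUV e ?_]
  rw [Finset.coe_union, Set.mem_union]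
  exact Or.inr he

omit [MeasurableSpace G] [BorelSpace G] in
/-- **The observable `g^h_{kl}` depends only on `P₀ ∪ ∅ ∪ M₀`** (`1 ≤ h`, `h + 1 ≤ L/2`).
[folklore] -/
theorem dependsOn_gSite (hρ : Continuous ρ) (β : ℝ) (hj : j ≠ 0) {h : ℕ} (h1 : 1 ≤ h)
    (hh : h + 1 ≤ L / 2) (m : ℕ) (k l : Fin N) :
    DependsOn (fun U : GaugeConfig d L G =>
      CompactGroup.unitarize ρ hρ
          ((lineHolonomy U 0 h ((0 : Site d L) + Pi.single 0 (((L / 2 : ℕ)) : ZMod L) +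
              Pi.single 0 (-((h : ℕ) : ZMod L))))⁻¹ *
            lineHolonomy U j m ((0 : Site d L) + Pi.single 0 (((L / 2 : ℕ)) : ZMod L) +
              Pi.single 0 (-((h : ℕ) : ZMod L))) *
            lineHolonomy U 0 h ((0 : Site d L) + Pi.single 0 (((L / 2 : ℕ)) : ZMod L) +
              Pi.single 0 (-((h : ℕ) : ZMod L)) + Pi.single j ((m : ℕ) : ZMod L))) k l *
        ((Real.exp (β * ((∑ p ∈ PosP, plaqRe ρ U p) + (∑ p ∈ MP, plaqRe ρ U p) / 2)) : ℝ) : ℂ))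
      (((P₀S) ∪ ∅ ∪ (M₀S) : Finset (Edge d L)) : Set (Edge d L)) := by
  intro U V hUV
  simp only [downStaple_congr hj h1 hh m hUV, weightSite_congr ρ β hUV]

omit [Fact (1 < L)] in
/-- **The double-integral pairing of the abstract mechanism with `C = ∅` and no Gram factor is
the single integral `∫ Φ · conj (Ψ ∘ Θ₀)`.** [folklore] -/
theorem pair_empty_eq (Φ Ψ : GaugeConfig d L G → ℂ) :
    ∫ pp, Φ (LatticeRP.splice (∅ : Finset (Edge d L)) pp) *
        conj (Ψ ((fun U : GaugeConfig d L G =>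
          (torusConfigShift (Pi.single (0 : Fin d) (1 : ZMod L)) U).timeReflect) pp.1)) *
        Complex.exp (∑ i : Fin 0, (fun (_ : Fin 0) (_ : GaugeConfig d L G) => (0 : ℂ)) i
          (LatticeRP.splice (∅ : Finset (Edge d L)) pp) *
          conj ((fun (_ : Fin 0) (_ : GaugeConfig d L G) => (0 : ℂ)) i
            ((fun U : GaugeConfig d L G =>
              (torusConfigShift (Pi.single (0 : Fin d) (1 : ZMod L)) U).timeReflect) pp.1)))
      ∂((LatticeRP.piMeasure (haarProbability G)).prod (LatticeRP.piMeasure (haarProbability G))) =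
    ∫ U, Φ U * conj (Ψ (torusConfigShift (Pi.single (0 : Fin d) (1 : ZMod L)) U).timeReflect)
      ∂(LatticeRP.piMeasure (haarProbability G)) := by
  simp only [Finset.univ_eq_empty, Finset.sum_empty, Complex.exp_zero, mul_one,
    LatticeRP.splice_eq_piecewise, Finset.piecewise_empty]
  rw [integral_fun_fst (fun U : GaugeConfig d L G =>
      Φ U * conj (Ψ (torusConfigShift (Pi.single (0 : Fin d) (1 : ZMod L)) U).timeReflect)),
    probReal_univ, one_smul]

omit [MeasurableSpace G] [BorelSpace G] in
/-- **The weighted loop cut by the lattice plane** (pointwise identity):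
`e^{-βS(U)} W_{(b+a+1)×m}(U) = e^{-βN#plaq} N⁻¹ Re ∑_{kl} g^b_{kl}(U) conj g^{a+1}_{kl}(Θ₀U)` for the
loop with `b` links below and `a + 1` links above the plane `t = L/2`
(`wilsonAction_split_site`, `re_trace_rectangleHolonomy_eq_sum_down`,
`upStaple_eq_downStaple_siteReflect`, `sumM_siteReflect`). [folklore] -/
theorem weight_mul_wilsonLoop_site [MeasurableSpace G] (hL : Even L) (hρ : Continuous ρ) (β : ℝ)
    (hj : j ≠ 0) (b a m : ℕ) (U : GaugeConfig d L G) :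
    Real.exp (-β * wilsonAction ρ U) *
        wilsonLoop ρ ((0 : Site d L) + Pi.single 0 (((L / 2 : ℕ)) : ZMod L) +
          Pi.single 0 (-((b : ℕ) : ZMod L))) 0 j (b + (a + 1)) m U =
      Real.exp (-β * (N * Fintype.card (Plaquette d L))) * (N : ℝ)⁻¹ *
        (∑ kl : Fin N × Fin N,
          (CompactGroup.unitarize ρ hρ
              ((lineHolonomy U 0 b ((0 : Site d L) + Pi.single 0 (((L / 2 : ℕ)) : ZMod L) +
                  Pi.single 0 (-((b : ℕ) : ZMod L))))⁻¹ *
                lineHolonomy U j m ((0 : Site d L) + Pi.single 0 (((L / 2 : ℕ)) : ZMod L) +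
                  Pi.single 0 (-((b : ℕ) : ZMod L))) *
                lineHolonomy U 0 b ((0 : Site d L) + Pi.single 0 (((L / 2 : ℕ)) : ZMod L) +
                  Pi.single 0 (-((b : ℕ) : ZMod L)) + Pi.single j ((m : ℕ) : ZMod L))) kl.1 kl.2 *
            ((Real.exp (β * ((∑ p ∈ PosP, plaqRe ρ U p) + (∑ p ∈ MP, plaqRe ρ U p) / 2)) : ℝ) : ℂ)) *
          conj (CompactGroup.unitarize ρ hρ
              ((lineHolonomy (torusConfigShift (Pi.single (0 : Fin d) (1 : ZMod L)) U).timeReflect 0 (a + 1)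
                  ((0 : Site d L) + Pi.single 0 (((L / 2 : ℕ)) : ZMod L) +
                    Pi.single 0 (-(((a + 1 : ℕ)) : ZMod L))))⁻¹ *
                lineHolonomy (torusConfigShift (Pi.single (0 : Fin d) (1 : ZMod L)) U).timeReflect j m
                  ((0 : Site d L) + Pi.single 0 (((L / 2 : ℕ)) : ZMod L) +
                    Pi.single 0 (-(((a + 1 : ℕ)) : ZMod L))) *
                lineHolonomy (torusConfigShift (Pi.single (0 : Fin d) (1 : ZMod L)) U).timeReflect 0 (a + 1)
                  ((0 : Site d L) + Pi.single 0 (((L / 2 : ℕ)) : ZMod L) +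
                    Pi.single 0 (-(((a + 1 : ℕ)) : ZMod L)) + Pi.single j ((m : ℕ) : ZMod L))) kl.1 kl.2 *
            ((Real.exp (β * ((∑ p ∈ PosP,
                plaqRe ρ (torusConfigShift (Pi.single (0 : Fin d) (1 : ZMod L)) U).timeReflect p) +
              (∑ p ∈ MP, plaqRe ρ (torusConfigShift (Pi.single (0 : Fin d) (1 : ZMod L)) U).timeReflect p) / 2))
                : ℝ) : ℂ))).re := by
  have h1L : 1 < L := Fact.out
  have hE := Nat.even_iff.mp hL
  have hc : ((0 : Site d L) + Pi.single 0 (((L / 2 : ℕ)) : ZMod L) : Site d L) 0 +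
      ((0 : Site d L) + Pi.single 0 (((L / 2 : ℕ)) : ZMod L) : Site d L) 0 = 0 := by
    simp only [Pi.add_apply, Pi.zero_apply, Pi.single_eq_same, zero_add]
    rw [← Nat.cast_add, show L / 2 + L / 2 = L by omega, ZMod.natCast_self]
  have htrace := re_trace_rectangleHolonomy_eq_sum_down ρ hρ U
    (torusConfigShift (Pi.single (0 : Fin d) (1 : ZMod L)) U).timeReflect
    ((0 : Site d L) + Pi.single 0 (((L / 2 : ℕ)) : ZMod L)) j b a m
    (upStaple_eq_downStaple_siteReflect U hc hj a m)
  rw [wilsonLoop, htrace, wilsonAction_split_site ρ hL hρ, sumM_siteReflect ρ hL]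
  simp only [map_mul (starRingEnd ℂ), Complex.conj_ofReal]
  rw [Fintype.sum_prod_type]
  simp only [Complex.re_sum]
  have hterm : ∀ (u v : ℂ) (r₁ r₂ : ℝ),
      (u * ((Real.exp r₁ : ℝ) : ℂ) * (conj v * ((Real.exp r₂ : ℝ) : ℂ))).re =
        Real.exp r₁ * Real.exp r₂ * (u * conj v).re := by
    intro u v r₁ r₂
    have : u * ((Real.exp r₁ : ℝ) : ℂ) * (conj v * ((Real.exp r₂ : ℝ) : ℂ)) =
      ((Real.exp r₁ * Real.exp r₂ : ℝ) : ℂ) * (u * conj v) := by push_cast; ring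
    rw [this, Complex.re_ofReal_mul]
  simp only [hterm, ← Finset.mul_sum]
  rw [← Real.exp_add,
    show -β * (↑N * ↑(Fintype.card (Plaquette d L)) -
        ((∑ p ∈ PosP, plaqRe ρ U p) +
          (∑ p ∈ PosP, plaqRe ρ (torusConfigShift (Pi.single (0 : Fin d) (1 : ZMod L)) U).timeReflect p) +
          (∑ p ∈ MP, plaqRe ρ U p))) =
      -β * (↑N * ↑(Fintype.card (Plaquette d L))) +
        (β * ((∑ p ∈ PosP, plaqRe ρ U p) + (∑ p ∈ MP, plaqRe ρ U p) / 2) +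
          β * ((∑ p ∈ PosP, plaqRe ρ (torusConfigShift (Pi.single (0 : Fin d) (1 : ZMod L)) U).timeReflect p) +
            (∑ p ∈ MP, plaqRe ρ U p) / 2)) by ring,
    Real.exp_add]
  ring

end Form


/-! ### The inequalities for the torus Wilson state -/

section Main

local notation "P₀S" => (Finset.univ.filter fun e : Edge d L =>
  ZMod.val (Prod.fst e 0) < L / 2 ∧ (Prod.snd e = 0 ∨ 1 ≤ ZMod.val (Prod.fst e 0)))
local notation "M₀S" => (Finset.univ.filter fun e : Edge d L =>
  Prod.snd e ≠ 0 ∧ (ZMod.val (Prod.fst e 0) = 0 ∨ ZMod.val (Prod.fst e 0) = L / 2))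
local notation "PosP" => (Finset.univ.filter fun p : Plaquette d L =>
  ZMod.val (Prod.fst p 0) < L / 2 ∧ (Prod.fst (Subtype.val (Prod.snd p)) = 0 ∨ 1 ≤ ZMod.val (Prod.fst p 0)))
local notation "MP" => (Finset.univ.filter fun p : Plaquette d L =>
  Prod.fst (Subtype.val (Prod.snd p)) ≠ 0 ∧ (ZMod.val (Prod.fst p 0) = 0 ∨ ZMod.val (Prod.fst p 0) = L / 2))

variable {j : Fin d}

/-- **Cauchy–Schwarz for the weighted loop integrals cut by the lattice plane.** With
`I(b, a) = ∫ e^{-βS} W` for the loop with `b ≥ 1` links below and `a + 1` links above the plane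
`t = L/2` (`b + 1 ≤ L/2`, `a + 2 ≤ L/2`): `0 ≤ I(b, b-1)` and `I(b, a)² ≤ I(b, b-1) · I(a+1, a)`,
i.e. `W(b+a+1)² ≤ W(2b) W(2(a+1))` before normalisation. [folklore] -/
theorem wilsonIntegral_sq_le_site (hL : Even L) (hρ : Continuous ρ) (β : ℝ) (hj : j ≠ 0)
    {b a : ℕ} (hb1 : 1 ≤ b) (hb : b + 1 ≤ L / 2) (ha : a + 2 ≤ L / 2) (m : ℕ) :
    0 ≤ ∫ U, Real.exp (-β * wilsonAction ρ U) *
        wilsonLoop ρ ((0 : Site d L) + Pi.single 0 (((L / 2 : ℕ)) : ZMod L) +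
          Pi.single 0 (-((b : ℕ) : ZMod L))) 0 j (b + b) m U
          ∂(LatticeRP.piMeasure (haarProbability G)) ∧
    (∫ U, Real.exp (-β * wilsonAction ρ U) *
        wilsonLoop ρ ((0 : Site d L) + Pi.single 0 (((L / 2 : ℕ)) : ZMod L) +
          Pi.single 0 (-((b : ℕ) : ZMod L))) 0 j (b + (a + 1)) m U
          ∂(LatticeRP.piMeasure (haarProbability G))) ^ 2 ≤
      (∫ U, Real.exp (-β * wilsonAction ρ U) *
        wilsonLoop ρ ((0 : Site d L) + Pi.single 0 (((L / 2 : ℕ)) : ZMod L) +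
          Pi.single 0 (-((b : ℕ) : ZMod L))) 0 j (b + b) m U
          ∂(LatticeRP.piMeasure (haarProbability G))) *
      (∫ U, Real.exp (-β * wilsonAction ρ U) *
        wilsonLoop ρ ((0 : Site d L) + Pi.single 0 (((L / 2 : ℕ)) : ZMod L) +
          Pi.single 0 (-(((a + 1 : ℕ)) : ZMod L))) 0 j ((a + 1) + (a + 1)) m U
          ∂(LatticeRP.piMeasure (haarProbability G))) := by
  set μH : Measure (GaugeConfig d L G) := LatticeRP.piMeasure (haarProbability G) with hμH
  have hΘm : Measurable fun U : GaugeConfig d L G =>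
      (torusConfigShift (Pi.single (0 : Fin d) (1 : ZMod L)) U).timeReflect :=
    (measurePreserving_siteReflect (d := d) (L := L) (G := G)).measurable
  -- the families `g^h`, `h = b` and `h = a + 1`
  set g : ℕ → Fin N × Fin N → GaugeConfig d L G → ℂ := fun h kl U =>
    CompactGroup.unitarize ρ hρ
        ((lineHolonomy U 0 h ((0 : Site d L) + Pi.single 0 (((L / 2 : ℕ)) : ZMod L) +
            Pi.single 0 (-((h : ℕ) : ZMod L))))⁻¹ *
          lineHolonomy U j m ((0 : Site d L) + Pi.single 0 (((L / 2 : ℕ)) : ZMod L) +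
            Pi.single 0 (-((h : ℕ) : ZMod L))) *
          lineHolonomy U 0 h ((0 : Site d L) + Pi.single 0 (((L / 2 : ℕ)) : ZMod L) +
            Pi.single 0 (-((h : ℕ) : ZMod L)) + Pi.single j ((m : ℕ) : ZMod L))) kl.1 kl.2 *
      ((Real.exp (β * ((∑ p ∈ PosP, plaqRe ρ U p) + (∑ p ∈ MP, plaqRe ρ U p) / 2)) : ℝ) : ℂ) with hg
  have hgm : ∀ h kl, Measurable (g h kl) := fun h kl => measurable_gSite ρ hρ β h m kl.1 kl.2
  have hgb : ∀ h kl U, ‖g h kl U‖ ≤ Real.exp (|β| * (2 * (N * Fintype.card (Plaquette d L)))) :=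
    fun h kl U => norm_gSite_le ρ hρ β h m kl.1 kl.2 U
  have hgd : ∀ h, 1 ≤ h → h + 1 ≤ L / 2 → ∀ kl, DependsOn (g h kl)
      (((P₀S) ∪ ∅ ∪ (M₀S) : Finset (Edge d L)) : Set (Edge d L)) :=
    fun h h1 hh kl => dependsOn_gSite ρ hρ β hj h1 hh m kl.1 kl.2
  -- the bridge: `∫ e^{-βS} W = κ Re ∑ ∫ g^b conj (g^{a'+1} ∘ Θ₀)`
  set κ : ℝ := Real.exp (-β * (N * Fintype.card (Plaquette d L))) * (N : ℝ)⁻¹ with hκ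
  have hκ0 : 0 ≤ κ := by positivity
  have hbridge : ∀ b' a' : ℕ, ∫ U, Real.exp (-β * wilsonAction ρ U) *
      wilsonLoop ρ ((0 : Site d L) + Pi.single 0 (((L / 2 : ℕ)) : ZMod L) +
        Pi.single 0 (-((b' : ℕ) : ZMod L))) 0 j (b' + (a' + 1)) m U ∂μH =
      κ * (∑ kl : Fin N × Fin N, ∫ U, g b' kl U *
        conj (g (a' + 1) kl (torusConfigShift (Pi.single (0 : Fin d) (1 : ZMod L)) U).timeReflect) ∂μH).re := by
    intro b' a'
    have hi : ∀ kl, Integrable (fun U => g b' kl U *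
        conj (g (a' + 1) kl (torusConfigShift (Pi.single (0 : Fin d) (1 : ZMod L)) U).timeReflect)) μH :=
      fun kl => LatticeRP.integrable_of_norm_le ((hgm b' kl).mul
        (Complex.continuous_conj.measurable.comp ((hgm (a' + 1) kl).comp hΘm)))
        (K := Real.exp (|β| * (2 * (N * Fintype.card (Plaquette d L)))) *
          Real.exp (|β| * (2 * (N * Fintype.card (Plaquette d L))))) fun U => by
        rw [norm_mul, Complex.norm_conj]
        exact mul_le_mul (hgb _ _ _) (hgb _ _ _) (norm_nonneg _) (Real.exp_pos _).le
    have hpt : ∀ U, Real.exp (-β * wilsonAction ρ U) *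
        wilsonLoop ρ ((0 : Site d L) + Pi.single 0 (((L / 2 : ℕ)) : ZMod L) +
          Pi.single 0 (-((b' : ℕ) : ZMod L))) 0 j (b' + (a' + 1)) m U =
        κ * (∑ kl : Fin N × Fin N, g b' kl U *
          conj (g (a' + 1) kl (torusConfigShift (Pi.single (0 : Fin d) (1 : ZMod L)) U).timeReflect)).re :=
      fun U => weight_mul_wilsonLoop_site ρ hL hρ β hj b' a' m U
    simp_rw [hpt]
    rw [integral_const_mul]
    congr 1
    have hI : Integrable (fun U => ∑ kl : Fin N × Fin N, g b' kl U *
        conj (g (a' + 1) kl (torusConfigShift (Pi.single (0 : Fin d) (1 : ZMod L)) U).timeReflect)) μH :=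
      integrable_finsetSum _ fun kl _ => hi kl
    have hre := integral_re hI
    simp only [RCLike.re_to_complex] at hre
    rw [hre, integral_finsetSum _ fun kl _ => hi kl]
  -- Cauchy–Schwarz in the double-integral form of the abstract mechanism
  have hCS := re_sum_pair_sq_le (haarProbability G) (∅ : Finset (Edge d L))
    (fun U : GaugeConfig d L G => (torusConfigShift (Pi.single (0 : Fin d) (1 : ZMod L)) U).timeReflect)
    (fun (_ : Fin 0) (_ : GaugeConfig d L G) => (0 : ℂ)) (M₀S) (P₀S)
    measurePreserving_siteReflect (fun U e he => siteReflect_apply_of_mem_M hL U e he)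
    (fun e he => dependsOn_siteReflect_apply hL e he) disjoint_M_P (Finset.disjoint_empty_right _)
    (fun _ => measurable_const) (Ka := 0) (fun _ _ => by simp) (fun _ _ _ _ => rfl)
    (hgm b) (hgm (a + 1)) (hgb b) (hgb (a + 1)) (hgd b hb1 hb) (hgd (a + 1) (by omega) ha)
  simp only [pair_empty_eq] at hCS
  obtain ⟨h0, hsq⟩ := hCS
  have e1 := hbridge b (b - 1)
  have e2 := hbridge b a
  have e3 := hbridge (a + 1) a
  rw [show b - 1 + 1 = b by omega] at e1
  rw [e1, e2, e3]
  refine ⟨mul_nonneg hκ0 h0, ?_⟩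
  rw [mul_pow, mul_mul_mul_comm, ← sq]
  exact mul_le_mul_of_nonneg_left hsq (sq_nonneg _)

/-- **Even-height rectangular Wilson loops have non-negative expectation** in the torus Wilson
state (`L` even): `0 ≤ ⟨W_{2b×m}⟩_{Λ,β}` for `1 ≤ b`, `b + 1 ≤ L/2`, the loop lying in the
`(0, j)` plane (the reflection-positive square of a downward staple for the lattice-plane
reflection). (Osterwalder–Seiler 1978 §2; Seiler LNP 159 §2.) [folklore] -/
theorem wilsonExpectation_wilsonLoop_nonneg_of_even (hL : Even L) (hρ : Continuous ρ) (β : ℝ)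
    (hj : j ≠ 0) {b : ℕ} (hb1 : 1 ≤ b) (hb : b + 1 ≤ L / 2) (m : ℕ) :
    0 ≤ wilsonExpectation ρ β (wilsonLoop ρ (0 : Site d L) 0 j (b + b) m) := by
  rw [← wilsonExpectation_wilsonLoop_eq_zero_base ρ β ((0 : Site d L) +
      Pi.single 0 (((L / 2 : ℕ)) : ZMod L) + Pi.single 0 (-((b : ℕ) : ZMod L))),
    wilsonExpectation_real_eq_toReal_mul_integral ρ hρ]
  have h := (wilsonIntegral_sq_le_site ρ hL hρ β hj hb1 hb (a := b - 1) (by omega) m).1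
  exact mul_nonneg ENNReal.toReal_nonneg h

/-- **Log-convexity of rectangular Wilson loops across the lattice planes** (torus Wilson
state, `L` even, loops in the `(0, j)` plane; `1 ≤ b`, `b + 1 ≤ L/2`, `a + 2 ≤ L/2`):
`⟨W_{(b+a+1)×m}⟩² ≤ ⟨W_{2b×m}⟩ · ⟨W_{2(a+1)×m}⟩`. The Schwarz inequality of reflection positivity
in the lattice hyperplanes `t = 0, L/2` applied to downward staples, followed by translation
invariance of the torus state (Osterwalder–Seiler 1978 §2; Seiler LNP 159 §2, existence of the
static quark potential). [folklore] -/
theorem wilsonExpectation_wilsonLoop_sq_le_of_site (hL : Even L) (hρ : Continuous ρ) (β : ℝ)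
    (hj : j ≠ 0) {b a : ℕ} (hb1 : 1 ≤ b) (hb : b + 1 ≤ L / 2) (ha : a + 2 ≤ L / 2) (m : ℕ) :
    wilsonExpectation ρ β (wilsonLoop ρ (0 : Site d L) 0 j (b + (a + 1)) m) ^ 2 ≤
      wilsonExpectation ρ β (wilsonLoop ρ (0 : Site d L) 0 j (b + b) m) *
        wilsonExpectation ρ β (wilsonLoop ρ (0 : Site d L) 0 j ((a + 1) + (a + 1)) m) := by
  rw [← wilsonExpectation_wilsonLoop_eq_zero_base ρ β ((0 : Site d L) +
      Pi.single 0 (((L / 2 : ℕ)) : ZMod L) + Pi.single 0 (-((b : ℕ) : ZMod L))) 0 j (b + (a + 1)),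
    ← wilsonExpectation_wilsonLoop_eq_zero_base ρ β ((0 : Site d L) +
      Pi.single 0 (((L / 2 : ℕ)) : ZMod L) + Pi.single 0 (-((b : ℕ) : ZMod L))) 0 j (b + b),
    ← wilsonExpectation_wilsonLoop_eq_zero_base ρ β ((0 : Site d L) +
      Pi.single 0 (((L / 2 : ℕ)) : ZMod L) + Pi.single 0 (-(((a + 1 : ℕ)) : ZMod L))) 0 j
      ((a + 1) + (a + 1)),
    wilsonExpectation_real_eq_toReal_mul_integral ρ hρ, wilsonExpectation_real_eq_toReal_mul_integral ρ hρ,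
    wilsonExpectation_real_eq_toReal_mul_integral ρ hρ]
  obtain ⟨-, hsq⟩ := wilsonIntegral_sq_le_site ρ hL hρ β hj hb1 hb ha m
  rw [mul_pow, mul_mul_mul_comm, ← sq]
  exact mul_le_mul_of_nonneg_left hsq (sq_nonneg _)

end Main

end StringTension

end Literature.MathematicalPhysics.QuantumFieldTheory
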